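import Summits.NavierStokesRegularity.NavierStokesRegularity.Theorems.ScenarioCensusRowF1IntStretch
import Summits.NavierStokesRegularity.NavierStokesRegularity.Theorems.ScenarioCensusRowF1FrozenTop
import HarnessLib

/-!
# LINE «integrated-stretch» port, part 2/5: §3 the singular Type-I zoom package with Hessians and third-order data; §4 fast points and the upgrade of a closed
# scale-invariant sign condition; §5 (a) the zoom chart of `ℝ × ℝ³` and its measure-theoretic calculus

Re-homed for the scenario census (typer seat ns-census-typer-1 g8; the cells F1ip / F1ipb and the floors DP / DX are MEMBERS OF RECORD «DECIDED IN KERNEL IN FILES» of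
row F1 since census v1.76 (critic idea-crit-3 g7 PASS — no price 01:59:32Z; ref ns-census-ref g10 PRE-CHECK ✓ §15.8–10; lead-presearch label); this port makes them
TREE-decided): VERBATIM PORT of ns-idea-3 LINE 23 «integrated-stretch», `pub/ideators/ns-idea-3/lines/integrated-stretch/line-integrated-stretch.lean` sha16
1cd526fed4663244 (1567 l., lean check rc 0, 0 sorry), split for the 400-line rule into `ScenarioCensusRowF1IntStretch` (§1–§2) → `…IntStretchZoom` (§3–§5a) →
`…IntStretchTransfer` (§5b) → `…IntStretchKill` (§6–§7) → `…IntStretchBudget` (§8 + census KEYS).  Lean text VERBATIM in namespace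
`…Theorems.ScenarioCensus.IntegratedStretch` (the line's `…Cruxes.ScenarioCensusRowF1.IntegratedStretchLine` re-homed); port edits: the bracket lines `section
IntegralTransfer` / `end IntegralTransfer` dropped (no `variable`s; the section spans two parts), `@[conjecture]` on the residual `IpSlack` (≡ `ScenarioCensus.Row_F1`,
OPEN), four one-line docstrings added (gate lint); lemmas the line shares VERBATIM with the landed inviscid-top / frozen-top / columnar-top / stretched-top ports are
taken BY NAME (listed below).  Statements untouched.

No census VALUE is moved here (row F1 stays OPEN-WITH-LINE; the members become TREE-decided by name); NS regularity is NOT proved; `Row_F1` is untouched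
(zero movement, `ipSlack_iff_rowF1`); no summit statement is proved by this file. Lemmas that restate already-landed tree declarations are taken BY NAME (gate lint `dedup.landed`): `fderiv_smul_stPull_apply` = `InviscidTop.fderiv_smul_stPull_apply`, `fderiv_smul_stPull` = `InviscidTop.fderiv_smul_stPull`, `fderiv_fderiv_smul_stPull` = `InviscidTop.fderiv_fderiv_smul_stPull`, `tendsto_clm_of_tendsto_apply` = `InviscidTop.tendsto_clm_of_tendsto_apply`, `tendsto_fderiv_fderiv_apply_of_bound` = `InviscidTop.tendsto_fderiv_fderiv_apply_of_bound`, `tendsto_fderiv_fderiv_of_bound` = `InviscidTop.tendsto_fderiv_fderiv_of_bound`, `tendsto_fderiv_fderiv_of_typeI_seq_Ioo` = `InviscidTop.tendsto_fderiv_fderiv_of_typeI_seq_Ioo`, `sing_of_not_bounded` = `InviscidTop.sing_of_not_bounded`, `convect_curl_self` = `FrozenTop.convect_curl_self`, `fderiv3_smul_stPull` = `FrozenTop.fderiv3_smul_stPull`, `tendsto_fderiv3_of_typeI_seq_Ioo` = `FrozenTop.tendsto_fderiv3_of_typeI_seq_Ioo`, `radius_eq` = `FrozenTop.radius_eq`,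 `jointCond_everywhere₆` = `FrozenTop.jointCond_everywhere₄`, `tendsto_physicalTime` = `ColumnarTop.tendsto_physicalTime`, `eventually_fast` = `ColumnarTop.eventually_fast`, `sqrt_timeLag` = `StretchedTop.sqrt_timeLag`, `forall_of_forall_ne_zero` = `StretchedTop.forall_of_forall_ne_zero`, `cert_ineq_of_stretching` = `StretchedTop.cert_ineq_of_stretching`, `typeI_ancient_eq_zero_of_subcriticalStretching` = `StretchedTop.typeI_ancient_eq_zero_of_subcriticalStretching`, `exists_singularZoom_package₃` = `FrozenTop.exists_singularZoom_package₃`, `lapD_eq_zero_of_eq_zero` = `FrozenTop.lapD_eq_zero_of_eq_zero`.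
-/

-- the summit and its single problem share the name `NavierStokesRegularity` (D-0017 nested layout)
set_option linter.dupNamespace false

noncomputable section

open MeasureTheory Set Function Filter TopologicalSpace Metric
open scoped Topology NNReal ENNReal InnerProductSpace RealInnerProductSpace Laplacian

namespace Summit.NavierStokesRegularity.NavierStokesRegularity.Theorems.ScenarioCensus.IntegratedStretch

open Literature.Analysis Literature.Analysis.FluidPDE
open Summit.NavierStokesRegularity.NavierStokesRegularity.Theorems

/-! ## §3 The singular Type-I zoom package with Hessians and third-order data -/

-- `exists_singularZoom_package₃`: the line restates the tree's `FrozenTop.exists_singularZoom_package₃`; taken BY NAME (gate lint dedup.landed).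

/-! ## §4 Fast points of the zoom, and the upgrade of a closed scale-invariant sign condition from `{W ≠ 0}` to
everywhere in `𝒦` (LINE 21 §6 / LINE 22 §5, the parts the integral transfer uses; re-proved verbatim) -/

-- `tendsto_physicalTime`: the line restates the tree's `ColumnarTop.tendsto_physicalTime`; taken BY NAME (gate lint dedup.landed).

-- `sqrt_timeLag`: the line restates the tree's `StretchedTop.sqrt_timeLag`; taken BY NAME (gate lint dedup.landed).

-- `eventually_fast`: the line restates the tree's `ColumnarTop.eventually_fast`; taken BY NAME (gate lint dedup.landed).

-- `radius_eq`: the line restates the tree's `FrozenTop.radius_eq`; taken BY NAME (gate lint dedup.landed).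

-- `forall_of_forall_ne_zero`: the line restates the tree's `StretchedTop.forall_of_forall_ne_zero`; taken BY NAME (gate lint dedup.landed).

-- `lapD_eq_zero_of_eq_zero`: the line restates the tree's `FrozenTop.lapD_eq_zero_of_eq_zero`; taken BY NAME (gate lint dedup.landed).

-- `jointCond_everywhere₆`: the line restates the tree's `FrozenTop.jointCond_everywhere₄`; taken BY NAME (gate lint dedup.landed).

/-! ## §5 THE TOOL — space–time `lintegral` TRANSFER through the singular zoom (LINE 22 §6, re-proved verbatim)

An INTEGRATED hypothesis `∫∫_{fast} (ν(T−t))^{1/2} · max 0 Rd(u/ν, ∇u/ν, ∇²u/ν, K/ν) < ∞` (weight-6 read-out `Rd`,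
the scale-invariant space–time weight `(T − t)^{1/2}`) passes to the zoom limit as `Rd(W, ∇W, ∇²W, ΣD³W eᵢeᵢ) ≤ 0`
at every point of the open past where `W ≠ 0` — by SCALE INVARIANCE of the weighted space–time integral (affine change
of variables on `ℝ × ℝ³`), ABSOLUTE CONTINUITY of the finite integral on the shrinking zoom boxes, and FATOU on a
box where the limit read-out would be positive.  No `ε`, no `M`, no compactness-in-`ε`. -/

/-- The zoom chart `Φ (s, y) = (T + a s, x₀ + b y)` of `ℝ × ℝ³` as a measurable equivalence (`a, b ≠ 0`). -/
def zoomChart (T a : ℝ) (x₀ : E3) (b : ℝ) (ha : a ≠ 0) (hb : b ≠ 0) : ℝ × E3 ≃ᵐ ℝ × E3 :=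
  MeasurableEquiv.prodCongr
    (((Homeomorph.mulLeft₀ a ha).trans (Homeomorph.addLeft T)).toMeasurableEquiv)
    (((Homeomorph.smulOfNeZero b hb).trans (Homeomorph.addLeft x₀)).toMeasurableEquiv)

/-- Unfolding the zoom chart. -/
theorem zoomChart_apply (T a : ℝ) (x₀ : E3) (b : ℝ) (ha : a ≠ 0) (hb : b ≠ 0) (z : ℝ × E3) :
    zoomChart T a x₀ b ha hb z = (T + a * z.1, x₀ + b • z.2) := rfl

/-- The zoom chart as a function. -/
theorem coe_zoomChart (T a : ℝ) (x₀ : E3) (b : ℝ) (ha : a ≠ 0) (hb : b ≠ 0) :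
    ⇑(zoomChart T a x₀ b ha hb) = Prod.map (fun s : ℝ => T + a * s) (fun y : E3 => x₀ + b • y) := rfl

/-- **Scale covariance of space–time volume**: `Φ_* vol = (a b³)⁻¹ vol`. -/
theorem map_zoomChart_volume {T a b : ℝ} {x₀ : E3} (ha : 0 < a) (hb : 0 < b) :
    Measure.map (zoomChart T a x₀ b ha.ne' hb.ne') volume = ENNReal.ofReal (a * b ^ 3)⁻¹ • volume := by
  have h1 : Measure.map (fun s : ℝ => T + a * s) volume = ENNReal.ofReal a⁻¹ • volume := by
    rw [show (fun s : ℝ => T + a * s) = (fun s => T + s) ∘ (fun s => a * s) from rfl,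
      ← Measure.map_map (measurable_const_add T) (measurable_const_mul a),
      Real.map_volume_mul_left ha.ne', Measure.map_smul, map_add_left_eq_self, abs_of_pos (inv_pos.2 ha)]
  have h2 : Measure.map (fun y : E3 => x₀ + b • y) volume = ENNReal.ofReal (b ^ 3)⁻¹ • volume := by
    rw [show (fun y : E3 => x₀ + b • y) = (fun y => x₀ + y) ∘ (fun y => b • y) from rfl,
      ← Measure.map_map (measurable_const_add x₀) (measurable_const_smul b),
      Measure.map_addHaar_smul volume hb.ne', Measure.map_smul, map_add_left_eq_self, finrank_euclideanSpace,
      Fintype.card_fin, abs_of_pos (inv_pos.2 (pow_pos hb 3))]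
  have hf : Measurable fun s : ℝ => T + a * s := (measurable_const_add T).comp (measurable_const_mul a)
  have hg : Measurable fun y : E3 => x₀ + b • y := (measurable_const_add x₀).comp (measurable_const_smul b)
  rw [coe_zoomChart, Measure.volume_eq_prod ℝ E3, ← Measure.map_prod_map _ _ hf hg, h1, h2,
    Measure.prod_smul_left, Measure.prod_smul_right, smul_smul, ← ENNReal.ofReal_mul (inv_nonneg.2 ha.le),
    mul_inv]

/-- `vol(Φ K) = a b³ · vol K`. -/
theorem volume_image_zoomChart {T a b : ℝ} {x₀ : E3} (ha : 0 < a) (hb : 0 < b) (K : Set (ℝ × E3)) :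
    volume (zoomChart T a x₀ b ha.ne' hb.ne' '' K) = ENNReal.ofReal (a * b ^ 3) * volume K := by
  set Φ := zoomChart T a x₀ b ha.ne' hb.ne'
  have h : (volume : Measure (ℝ × E3)).map Φ (Φ '' K) = volume (Φ ⁻¹' (Φ '' K)) :=
    MeasurableEquiv.map_apply Φ _
  rw [Φ.injective.preimage_image, map_zoomChart_volume ha hb, Measure.smul_apply, smul_eq_mul] at h
  have hD : 0 < a * b ^ 3 := by positivity
  calc volume (Φ '' K)
      = ENNReal.ofReal (a * b ^ 3) * (ENNReal.ofReal (a * b ^ 3)⁻¹ * volume (Φ '' K)) := by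
        rw [← mul_assoc, ← ENNReal.ofReal_mul hD.le, mul_inv_cancel₀ hD.ne', ENNReal.ofReal_one, one_mul]
    _ = ENNReal.ofReal (a * b ^ 3) * volume K := by rw [h]

/-- **Change of variables** for set `lintegral`s under the zoom chart: `∫_K F∘Φ = (a b³)⁻¹ ∫_{Φ K} F`
(no measurability of `F` needed). -/
theorem setLIntegral_comp_zoomChart {T a b : ℝ} {x₀ : E3} (ha : 0 < a) (hb : 0 < b) (F : ℝ × E3 → ℝ≥0∞)
    (K : Set (ℝ × E3)) :
    ∫⁻ z in K, F (zoomChart T a x₀ b ha.ne' hb.ne' z) =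
      ENNReal.ofReal (a * b ^ 3)⁻¹ * ∫⁻ z in zoomChart T a x₀ b ha.ne' hb.ne' '' K, F z := by
  set Φ := zoomChart T a x₀ b ha.ne' hb.ne'
  have hmap : Measure.map Φ (volume.restrict K) = ENNReal.ofReal (a * b ^ 3)⁻¹ • volume.restrict (Φ '' K) := by
    have h := Φ.measurableEmbedding.restrict_map volume (Φ '' K)
    rw [Φ.injective.preimage_image] at h
    rw [← h, map_zoomChart_volume ha hb, Measure.restrict_smul]
  rw [← lintegral_map_equiv F Φ, hmap, lintegral_smul_measure, smul_eq_mul]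

/-- `Φ`-pullbacks of an a.e.-measurable function are a.e.-measurable (`Φ_* vol ≪ vol`). -/
theorem aemeasurable_comp_zoomChart {T a b : ℝ} {x₀ : E3} (ha : 0 < a) (hb : 0 < b) {F : ℝ × E3 → ℝ≥0∞}
    (hF : AEMeasurable F volume) : AEMeasurable (fun z => F (zoomChart T a x₀ b ha.ne' hb.ne' z)) volume := by
  refine hF.comp_quasiMeasurePreserving ⟨(zoomChart T a x₀ b ha.ne' hb.ne').measurable, ?_⟩
  rw [map_zoomChart_volume ha hb]
  exact Measure.smul_absolutelyContinuous

/-- Joint continuity of (value, gradient, Hessian, `Σᵢ D³(·) eᵢ eᵢ`) of a jointly smooth space–time field. -/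
theorem continuousOn_quad {S : Set ℝ} (hS : UniqueDiffOn ℝ S) {w : ℝ → E3 → E3} (hw : IsSmoothSpaceTimeOn S w) :
    ContinuousOn (fun z : ℝ × E3 =>
      (w z.1 z.2, fderiv ℝ (w z.1) z.2, fderiv ℝ (fderiv ℝ (w z.1)) z.2, lapD (w z.1) z.2)) (S ×ˢ univ) := by
  have h0 : ContinuousOn (fun z : ℝ × E3 => w z.1 z.2) (S ×ˢ univ) := hw.continuousOn
  have h1s : IsSmoothSpaceTimeOn S (fun t x => fderiv ℝ (w t) x) := hw.fderiv_slice hS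
  have h1 : ContinuousOn (fun z : ℝ × E3 => fderiv ℝ (w z.1) z.2) (S ×ˢ univ) := h1s.continuousOn
  have h2s : IsSmoothSpaceTimeOn S (fun t x => fderiv ℝ (fderiv ℝ (w t)) x) := h1s.fderiv_slice hS
  have h2 : ContinuousOn (fun z : ℝ × E3 => fderiv ℝ (fderiv ℝ (w z.1)) z.2) (S ×ˢ univ) := h2s.continuousOn
  -- continuity of `z ↦ Σᵢ D³w eᵢ eᵢ` WITHOUT a topology on the space of third derivatives:
  -- `D³w(y) eᵢ eᵢ = D(x ↦ D²w(x) eᵢ)(y) eᵢ` (as in `FrozenTop.jointCond_everywhere₄`)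
  have hl : ContinuousOn (fun z : ℝ × E3 => lapD (w z.1) z.2) (S ×ˢ univ) := by
    have hi : ∀ i, ContinuousOn (fun z : ℝ × E3 =>
        fderiv ℝ (fun x => fderiv ℝ (fderiv ℝ (w z.1)) x (eI i)) z.2 (eI i)) (S ×ˢ univ) := by
      intro i
      have hK : IsSmoothSpaceTimeOn S (fun (_ : ℝ) (_ : E3) => eI i) := contDiffOn_const
      have g2 : IsSmoothSpaceTimeOn S (fun t x => fderiv ℝ (fderiv ℝ (w t)) x (eI i)) := h2s.clm_apply hK
      have g3 : IsSmoothSpaceTimeOn S (fun t x => fderiv ℝ (fun x => fderiv ℝ (fderiv ℝ (w t)) x (eI i)) x) :=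
        g2.fderiv_slice hS
      have g4 : IsSmoothSpaceTimeOn S (fun t x =>
          fderiv ℝ (fun x => fderiv ℝ (fderiv ℝ (w t)) x (eI i)) x (eI i)) := g3.clm_apply hK
      exact g4.continuousOn
    have hsum := continuousOn_finsetSum (Finset.univ : Finset (Fin 3)) fun i _ => hi i
    refine hsum.congr ?_
    rintro ⟨t, x⟩ ⟨ht, -⟩
    have hsm := hw.contDiff_slice ht
    have hd2 : ContDiff ℝ 2 (fderiv ℝ (w t)) :=
      (hsm.of_le (by norm_cast : ((3 : ℕ) : WithTop ℕ∞) ≤ _)).fderiv_right (by norm_cast)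
    have hd3 : ContDiff ℝ 1 (fderiv ℝ (fderiv ℝ (w t))) := hd2.fderiv_right (by norm_cast)
    show lapD (w t) x = ∑ i, fderiv ℝ (fun z => fderiv ℝ (fderiv ℝ (w t)) z (eI i)) x (eI i)
    unfold lapD
    refine Finset.sum_congr rfl fun i _ => ?_
    rw [fderiv_clm_apply (hd3.differentiable (by simp) x) (differentiableAt_const _)]
    simp
  exact h0.prodMk (h1.prodMk (h2.prodMk hl))

/-- The weight identity `√(ν (T − τ_j)) = c_j R √(−t)` (`R² = ν β`). -/
theorem sqrt_nu_timeLag {T ν t α β R : ℝ} (hν : 0 < ν) (hα : 0 < α) (hβ : 0 < β) (hαR : α * R = β)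
    (hαν : α * Real.sqrt ν = Real.sqrt β) {c : ℕ → ℝ} (hcpos : ∀ j, 0 < c j) (j : ℕ) :
    Real.sqrt (ν * (T - (T + c j ^ 2 * β * t))) = c j * R * Real.sqrt (-t) := by
  have hR := FrozenTop.radius_eq hν hα hβ hαR hαν
  have hβ' : β = ν * α ^ 2 := by rw [← hαR, hR]; ring
  have e : ν * (T - (T + c j ^ 2 * β * t)) = (c j * R) ^ 2 * (-t) := by rw [hR, hβ']; ring
  rw [e, Real.sqrt_mul (sq_nonneg _), Real.sqrt_sq (mul_pos (hcpos j) (by rw [hR]; positivity)).le]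

end Summit.NavierStokesRegularity.NavierStokesRegularity.Theorems.ScenarioCensus.IntegratedStretch

end
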